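import Mathlib
import HarnessLib
import Literature.Probability.MarkovChains.MetropolisHastings

/-!
# LatticeQCDFlow / Exactness — a fresh-noise ("Monte Carlo within Metropolis") acceptance is NOT
exact: the smallest witness, and its exact pseudo-marginal twin

HONEST FRAMING: exact (Metropolis-corrected) sampling algorithms for lattice gauge theory;
figures of merit are autocorrelation/cost numbers at stated couplings and volumes; no
continuum-physics claim.

Venture `LatticeQCDFlow` (cell pub-lqcd), topic `Exactness`; landed by FANOUT row 38 (r2-scope) as
the Lean face of the planted control INVALID-4 = "stochastic determinant without correction"
(HOME/FITNESS.md §5; HOME/R2-SCOPE.md §3 N1, §5 X-5a / V-4a, §8 L-R2-3).  NEW WORK of the cell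
(elementary finite arithmetic), not a published result; printed counterparts are named in
docstrings only.

Setting.  A Metropolis–Hastings chain for a target `π` on a finite `X` whose density cannot be
evaluated, only ESTIMATED without bias: `f x ξ` with noise `ξ ∼ g`, `Σ_ξ g ξ · f x ξ = π x`
(for dynamical fermions: `f` = gauge weight × a one-noise pseudofermion estimate of the
determinant).  Two ways to use the estimate in the accept/reject step:

* FRESH NOISE at every step for BOTH the current and the proposed state ("Monte Carlo within
  Metropolis"; the "stochastic estimates of ratios" scheme of which Albergo et al. 2021,
  arXiv:2106.05934 §III.A footnote, say "asymptotic exactness has not been demonstrated").  The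
  `X`-chain is then Markov with the noise-AVERAGED rate `mcwmRate` below.
* RECYCLED estimate for the current state (pseudo-marginal, Andrieu–Roberts 2009): exact — an
  ordinary Metropolis–Hastings chain on `X × Ξ` (the tree's
  `Literature.Probability.MarkovChains.mhKernel` with proposal `T x x' · g ξ'` and weight
  `g ξ · f x ξ`; the Literature-side file `PseudoMarginal.lean` of the same cell packages this).

Results (all proved):
* `mcwmRate`, `mcwmKernel`, `mcwmKernel_sum_eq_one` — the fresh-noise chain on `X` (any finite
  `X`, `Ξ`);
* `mcwmRate_eq_mhRate_of_exact` — with a noise-free estimator it IS Metropolis–Hastings (so the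
  defect below is caused by the fresh noise alone);
* THE WITNESS (`Fin 2`, target `π₂ = (1/3, 2/3)`, uniform proposals, multiplicative noise
  `c ∈ {1/2, 3/2}` equiprobable, `f₂ x ξ = π₂ x · c ξ`, unbiased — `f₂_unbiased`):
  `mcwmRate₂_zero_one : rate 0 → 1 = 11/24`, `mcwmRate₂_one_zero : rate 1 → 0 = 13/48`,
  `mcwm₂_not_stationary : ¬ IsStationary π₂ (mcwmKernel …)`,
  `mcwm₂_stationary_biased : IsStationary (13/35, 22/35) (mcwmKernel …)` — the fresh-noise chain
  samples `(13/35, 22/35)` instead of `(1/3, 2/3)`: a relative bias of `4/35 ≈ 11 %` on the first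
  state (`mcwm₂_relative_bias`), at acceptance rates that look healthy;
* THE EXACT TWIN on the same data: `pm₂_isStationary` (the pseudo-marginal kernel on
  `Fin 2 × Fin 2` leaves `g ξ · f₂ x ξ` invariant) and `pm₂_marginal` (its `X`-marginal is `π₂`).

Use: this is why the cell's scorer must separate "noise present and recycled" (VALID, control
V-4a) from "noise present and fresh" (INVALID, control X-5a) — the two chains use the same
estimator and differ only in bookkeeping.  Nothing here is specific to fermions or to flows; the
planted control on the Schwinger testbed T-R2-0 (R2-SCOPE.md §5) is the same construction with
`X` = gauge configurations and `f` = one-pseudofermion determinant estimate.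
-/

namespace Summit.Ventures.LatticeQCDFlow.Exactness

open Finset
open Literature.Probability.MarkovChains

/-! ## The fresh-noise (Monte-Carlo-within-Metropolis) chain on a finite space -/

section General

variable {X Ξ : Type*} [Fintype X] [Fintype Ξ] [DecidableEq X]

/-- Off-diagonal rate of the FRESH-NOISE chain: propose `y ∼ T x ·`, draw fresh noises `ξ` (for
the current state) and `ξ'` (for the candidate) from `g`, accept with
`min {1, f y ξ' · T y x / (f x ξ · T x y)}`; averaging over both noises gives the Markov rate on
`X`: `Σ_{ξ,ξ'} g ξ g ξ' · min (T x y) (f y ξ' T y x / f x ξ)`.  Venture definition (the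
"stochastic estimate of the ratio" scheme; Albergo et al. 2021 §III.A footnote). [folklore] -/
noncomputable def mcwmRate (T : X → X → ℝ) (f : X → Ξ → ℝ) (g : Ξ → ℝ) (x y : X) : ℝ :=
  ∑ ξ, ∑ ξ', g ξ * g ξ' * min (T x y) (f y ξ' * T y x / f x ξ)

/-- The fresh-noise chain's transition matrix on `X`: off-diagonal `mcwmRate`, rejected mass on the
diagonal. [folklore] -/
noncomputable def mcwmKernel (T : X → X → ℝ) (f : X → Ξ → ℝ) (g : Ξ → ℝ) (x y : X) : ℝ :=
  if y = x then 1 - ∑ z ∈ univ.erase x, mcwmRate T f g x z else mcwmRate T f g x y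

/-- Off-diagonal entries of the fresh-noise kernel. [folklore] -/
theorem mcwmKernel_of_ne (T : X → X → ℝ) (f : X → Ξ → ℝ) (g : Ξ → ℝ) {x y : X} (h : y ≠ x) :
    mcwmKernel T f g x y = mcwmRate T f g x y := if_neg h

/-- Diagonal entries of the fresh-noise kernel. [folklore] -/
theorem mcwmKernel_self (T : X → X → ℝ) (f : X → Ξ → ℝ) (g : Ξ → ℝ) (x : X) :
    mcwmKernel T f g x x = 1 - ∑ z ∈ univ.erase x, mcwmRate T f g x z := if_pos rfl

/-- Rows of the fresh-noise kernel sum to one (it IS a Markov chain on `X` — the defect is not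
here). [folklore] -/
theorem mcwmKernel_sum_eq_one (T : X → X → ℝ) (f : X → Ξ → ℝ) (g : Ξ → ℝ) (x : X) :
    ∑ y, mcwmKernel T f g x y = 1 := by
  rw [← add_sum_erase _ _ (mem_univ x), mcwmKernel_self]
  have : ∑ y ∈ univ.erase x, mcwmKernel T f g x y = ∑ y ∈ univ.erase x, mcwmRate T f g x y :=
    sum_congr rfl fun y hy => mcwmKernel_of_ne T f g (ne_of_mem_erase hy)
  rw [this]
  ring

omit [Fintype X] [DecidableEq X] in
/-- Sanity: with a NOISE-FREE estimator (`f x ξ = π x` for every `ξ`) and a normalised noise law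
the fresh-noise rate is the Metropolis–Hastings rate for `π` — the bias exhibited below is caused
by the fresh noise alone, not by the bookkeeping. [folklore] -/
theorem mcwmRate_eq_mhRate_of_exact {T : X → X → ℝ} {f : X → Ξ → ℝ} {g : Ξ → ℝ} {π : X → ℝ}
    (hf : ∀ x ξ, f x ξ = π x) (hg1 : ∑ ξ, g ξ = 1) (x y : X) :
    mcwmRate T f g x y = mhRate T π x y := by
  unfold mcwmRate mhRate
  simp_rw [hf, mul_assoc, ← mul_sum, ← sum_mul, hg1, one_mul]

end General

/-! ## The witness on two states -/

section Witness

/-- Target of the witness: `π₂ = (1/3, 2/3)` on `Fin 2`. [folklore] -/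
noncomputable def π₂ : Fin 2 → ℝ := ![1 / 3, 2 / 3]

/-- Proposal of the witness: uniform, `T₂ x y = 1/2` (an independence proposal). [folklore] -/
noncomputable def T₂ : Fin 2 → Fin 2 → ℝ := fun _ _ => 1 / 2

/-- Noise law of the witness: two equiprobable noise values. [folklore] -/
noncomputable def g₂ : Fin 2 → ℝ := fun _ => 1 / 2

/-- Multiplicative noise factors `c = (1/2, 3/2)`, mean one. [folklore] -/
noncomputable def c₂ : Fin 2 → ℝ := ![1 / 2, 3 / 2]

/-- The estimator of the witness: `f₂ x ξ = π₂ x · c₂ ξ` (positive, unbiased). [folklore] -/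
noncomputable def f₂ : Fin 2 → Fin 2 → ℝ := fun x ξ => π₂ x * c₂ ξ

/-- Value of the target at state `0`. [folklore] -/
@[simp] theorem π₂_zero : π₂ 0 = 1 / 3 := rfl
/-- Value of the target at state `1`. [folklore] -/
@[simp] theorem π₂_one : π₂ 1 = 2 / 3 := rfl
/-- First noise factor. [folklore] -/
@[simp] theorem c₂_zero : c₂ 0 = 1 / 2 := rfl
/-- Second noise factor. [folklore] -/
@[simp] theorem c₂_one : c₂ 1 = 3 / 2 := rfl
/-- The proposal is uniform. [folklore] -/
@[simp] theorem T₂_apply (x y : Fin 2) : T₂ x y = 1 / 2 := rfl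
/-- The noise law is uniform. [folklore] -/
@[simp] theorem g₂_apply (ξ : Fin 2) : g₂ ξ = 1 / 2 := rfl
/-- Unfolding the estimator. [folklore] -/
@[simp] theorem f₂_apply (x ξ : Fin 2) : f₂ x ξ = π₂ x * c₂ ξ := rfl

/-- The estimator is UNBIASED: `Σ_ξ g₂ ξ · f₂ x ξ = π₂ x` (mean noise factor `(1/2+3/2)/2 = 1`).
[folklore] -/
theorem f₂_unbiased (x : Fin 2) : ∑ ξ, g₂ ξ * f₂ x ξ = π₂ x := by
  rw [Fin.sum_univ_two]
  simp only [g₂_apply, f₂_apply, c₂_zero, c₂_one]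
  ring

/-- The estimator is positive. [folklore] -/
theorem f₂_pos (x ξ : Fin 2) : 0 < f₂ x ξ := by
  fin_cases x <;> fin_cases ξ <;> simp

/-- Fresh-noise rate `0 → 1`: `(1/2)·E[min(1, 2c'/c)] = (1/2)·(11/12) = 11/24`. [folklore] -/
theorem mcwmRate₂_zero_one : mcwmRate T₂ f₂ g₂ 0 1 = 11 / 24 := by
  simp only [mcwmRate, Fin.sum_univ_two, T₂_apply, g₂_apply, f₂_apply, π₂_zero, π₂_one, c₂_zero,
    c₂_one]
  norm_num [min_def]

/-- Fresh-noise rate `1 → 0`: `(1/2)·E[min(1, c'/(2c))] = (1/2)·(13/24) = 13/48`. [folklore] -/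
theorem mcwmRate₂_one_zero : mcwmRate T₂ f₂ g₂ 1 0 = 13 / 48 := by
  simp only [mcwmRate, Fin.sum_univ_two, T₂_apply, g₂_apply, f₂_apply, π₂_zero, π₂_one, c₂_zero,
    c₂_one]
  norm_num [min_def]

/-- `univ.erase 0 = {1}` in `Fin 2` (private helper). [folklore] -/
private theorem erase_zero₂ : (univ : Finset (Fin 2)).erase 0 = {1} := by decide
/-- `univ.erase 1 = {0}` in `Fin 2` (private helper). [folklore] -/
private theorem erase_one₂ : (univ : Finset (Fin 2)).erase 1 = {0} := by decide

/-- The four entries of the fresh-noise kernel of the witness. [folklore] -/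
theorem mcwmKernel₂_entries :
    mcwmKernel T₂ f₂ g₂ 0 1 = 11 / 24 ∧ mcwmKernel T₂ f₂ g₂ 1 0 = 13 / 48 ∧
      mcwmKernel T₂ f₂ g₂ 0 0 = 13 / 24 ∧ mcwmKernel T₂ f₂ g₂ 1 1 = 35 / 48 := by
  refine ⟨?_, ?_, ?_, ?_⟩
  · rw [mcwmKernel_of_ne _ _ _ (by decide), mcwmRate₂_zero_one]
  · rw [mcwmKernel_of_ne _ _ _ (by decide), mcwmRate₂_one_zero]
  · rw [mcwmKernel_self, erase_zero₂, sum_singleton, mcwmRate₂_zero_one]; norm_num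
  · rw [mcwmKernel_self, erase_one₂, sum_singleton, mcwmRate₂_one_zero]; norm_num

/-- **The fresh-noise acceptance is NOT exact**: `π₂ = (1/3, 2/3)` is not stationary for the
fresh-noise chain built from an UNBIASED estimator of `π₂` (flow into state `1`:
`(1/3)(11/24) + (2/3)(35/48) = 23/36 ≠ 2/3`).  Printed status of the scheme: "asymptotic
exactness has not been demonstrated" (Albergo et al. 2021, arXiv:2106.05934 §III.A footnote);
here it is refuted in the smallest model.  Venture result (planted control INVALID-4a / X-5a).
[folklore] -/
theorem mcwm₂_not_stationary : ¬ IsStationary π₂ (mcwmKernel T₂ f₂ g₂) := by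
  intro h
  have h1 := h 1
  obtain ⟨h01, -, -, h11⟩ := mcwmKernel₂_entries
  rw [Fin.sum_univ_two, h01, h11, π₂_zero, π₂_one] at h1
  norm_num at h1

/-- The law the fresh-noise chain DOES sample: `(13/35, 22/35)` is stationary (two-state chains
are reversible: `(13/35)(11/24) = (22/35)(13/48)`). [folklore] -/
theorem mcwm₂_stationary_biased : IsStationary ![(13 : ℝ) / 35, 22 / 35] (mcwmKernel T₂ f₂ g₂) := by
  obtain ⟨h01, h10, h00, h11⟩ := mcwmKernel₂_entries
  intro y
  fin_cases y
  · simp only [Fin.sum_univ_two, Fin.zero_eta, Matrix.cons_val_zero, Matrix.cons_val_one, h00, h10]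
    norm_num
  · simp only [Fin.sum_univ_two, Fin.mk_one, Matrix.cons_val_zero, Matrix.cons_val_one, h01, h11]
    norm_num

/-- Size of the defect: the fresh-noise chain's stationary weight of state `0` is `13/35`
instead of `1/3`, a relative bias of `4/35` (≈ 11 %), with mean-one noise of relative spread
`±50 %`. [folklore] -/
theorem mcwm₂_relative_bias : ((13 : ℝ) / 35 - 1 / 3) / (1 / 3) = 4 / 35 := by norm_num

/-! ## The exact twin on the same data: recycle the estimate (pseudo-marginal) -/

/-- The pseudo-marginal chain for the SAME `T₂, f₂, g₂`: Metropolis–Hastings on `Fin 2 × Fin 2`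
with proposal `T₂ x x' · g₂ ξ'` and weight `g₂ ξ · f₂ x ξ` (the current estimate is part of the
state, i.e. recycled). [folklore] -/
noncomputable def pmKernel₂ : Fin 2 × Fin 2 → Fin 2 × Fin 2 → ℝ :=
  mhKernel (fun z z' => T₂ z.1 z'.1 * g₂ z'.2) (fun z => g₂ z.2 * f₂ z.1 z.2)

/-- **The recycled (pseudo-marginal) twin IS exact**: the extended weight `g₂ ξ · f₂ x ξ` is
stationary (instance of the tree's `mhKernel_isStationary`; general finite form in
`Literature.Probability.MarkovChains.PseudoMarginal`). [folklore] -/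
theorem pm₂_isStationary :
    IsStationary (fun z : Fin 2 × Fin 2 => g₂ z.2 * f₂ z.1 z.2) pmKernel₂ :=
  mhKernel_isStationary
    (fun z : Fin 2 × Fin 2 => mul_pos (by rw [g₂_apply]; norm_num) (f₂_pos z.1 z.2)) _

/-- … and its `X`-marginal is exactly `π₂` (unbiasedness), so `π₂`-expectations are reproduced:
control V-4a must score VALID where X-5a scores INVALID. [folklore] -/
theorem pm₂_marginal (x : Fin 2) : ∑ ξ, g₂ ξ * f₂ x ξ = π₂ x := f₂_unbiased x

end Witness

end Summit.Ventures.LatticeQCDFlow.Exactness
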